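import Literature.Computability.Complexity.SignRat
import Literature.Computability.Complexity.OracleClockFst
import Literature.Computability.Complexity.FournierKoiranTransferOracle
import Literature.Computability.Complexity.PRelSigmaPi
import HarnessLib

/-!
# Fournier–Koiran's final `NP` check: "is there a digital witness accepted at the rational point?"

Topic `Literature/Computability/Complexity`, grouping namespace `FKTransfer`. The last paragraph
of the proof of Theorem 3 of Fournier–Koiran (ICALP 2000 = LIP RR-1999-21, pp. 11–12): once the
input `x` has been located, "it remains to check whether `P_S` is included in `L` … This can be
done by a standard NP algorithm: we guess a certificate `z ∈ {0,1}^{r(n)}` … (Another method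
consists in guessing a rational point `q ∈ P_S` with small coordinates … and then running `T` on
`⟨q, z⟩`)." In the sign-oracle rendering (`AdditiveRealClasses.lean`: the verifier is an oracle
algorithm `M` with a polynomial-time step function and budget polynomial `q`), with the rational
point SUPPLIED (as the code `ratCode d N` of `N/d`, `SignRat.lean`), this is the Boolean language

* `FinalCheck M q T = {w | ∃ y, |y| ≤ q|w| ∧ ⟨w, y⟩ ∈ finCert M q T}` — of `polyExists` shape, so
  **`FinalCheck_mem_NP`**: it is in `NP` as soon as `finCert ∈ P`;
* **`mem_FinalCheck_iff`**: `⟨1ⁿ, ratCode d N⟩ ∈ FinalCheck M q T ↔ ∃ y, |y| ≤ q(n) ∧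
  M.run (signOracle (N/d)) (q n) ⟨1ⁿ, y⟩ = some true` — the `NDPAdd` acceptance condition AT THE
  RATIONAL POINT (for `d > 0` and a query-length bound `T` of `M`, which exists:
  `FKPointLocation.exists_query_length_bound`);
* **`mem_FinalCheck_iff_of_agree`**: if the sign oracles of `x` and of `N/d` agree on every query
  `M` can ask on the inputs `⟨1ⁿ, y⟩` (report p. 11: `P_S` lies in one face of the arrangement of
  all test hyperplanes), the condition is the `NDPAdd` acceptance condition at `x` itself.

`finCert ∈ P` (`finCert_mem_P`) is `P^P = P` (`PRelClass_P_subset_P`) applied to ONE oracle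
algorithm `finAlg M q T` with the `P`-oracle `SignRat`, assembled from `M` by the query/input/clock
combinators of `OracleQueryMap.lean` / `OracleClockFst.lean` — `comap` (read `⟨1ⁿ, y⟩` off the
input `⟨1ⁿ, ⟨r, y⟩⟩`), `mapQuery` (prefix the point code `r` to every sign query), `capQ` (cap the
query length, never active on a genuine run: `T`), `clockFst` (budget `q(n)` read off the FIRST
field `1ⁿ`, so that acceptance means acceptance within exactly `q(n)` rounds) — whose polynomial
time is `isPolyTime_comap`/`_mapQuery`/`_capQ`/`_clockFst`; no machine is written here.

## References

* H. Fournier, P. Koiran, *Lower bounds are not easier over the reals: inside PH*, ICALP 2000,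
  LNCS 1853 = LIP RR-1999-21, Thm 3 and its proof, pp. 11–12. [FournierKoiran2000]
* S. Arora, B. Barak, *Computational Complexity: A Modern Approach*, CUP 2009, §3.4 (oracle
  machines), Def. 2.1 (`NP` by certificates). [AroraBarak2009]
-/

namespace Literature.Computability.Complexity

namespace FKTransfer

open _root_.Computability Polynomial Brick PRelSigma OracleAlg

/-- Length of a unary numeral. [folklore] -/
private theorem length_unaryEncodeNat (k : ℕ) : (unaryEncodeNat k).length = k := by
  induction k with
  | zero => rfl
  | succ k ih => rw [unaryEncodeNat, List.length_cons, ih]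

/-! ### The inner oracle algorithm -/

section Machine

variable (M : OracleAlg Bool) (q T : Polynomial ℕ)

/-- Input re-formatting `⟨u, ⟨r, y⟩⟩ ↦ ⟨u, y⟩` (the verifier's input). [folklore] -/
noncomputable def finPre : List Bool → List Bool :=
  fanoutFn fstF (sndF ∘ sndF)

/-- Query re-writing `⟨v, ⟨code as, qry⟩⟩ ↦ ⟨r, qry⟩` with `r` the middle field of `v = ⟨u, ⟨r, y⟩⟩`:
every sign query is prefixed with the code of the rational point. [cite: FournierKoiran2000, Thm 3 (p. 11: "running `T` on `⟨q, z⟩`")] -/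
noncomputable def finMap : List Bool → List Bool :=
  fanoutFn (fstF ∘ sndF ∘ fstF) (sndF ∘ sndF)

/-- The cap on the length of the re-written queries: `2|v| + 2 + T(|v|)`. [folklore] -/
noncomputable def capPoly : Polynomial ℕ :=
  C 2 * X + C 2 + T

/-- The core machine: the verifier `M` reading `⟨u, y⟩` off `⟨u, ⟨r, y⟩⟩`, its queries prefixed
with `r` and capped at `capPoly T`. [cite: FournierKoiran2000, Thm 3 (p. 11)] -/
noncomputable def finCore : OracleAlg Bool :=
  ((M.comap finPre).mapQuery finMap).capQ (capPoly T) false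

/-- **The inner oracle algorithm** `finAlg M q T`: `finCore M T` clocked by `q(|u|)`, the budget
read off the FIRST field `u = 1ⁿ` of the input. [cite: FournierKoiran2000, Thm 3 (p. 11)] -/
noncomputable def finAlg : OracleAlg Bool :=
  (finCore M T).clockFst q false

variable {M q T}

/-- Value of `finPre`. [folklore] -/
@[simp] theorem finPre_apply (u r y : List Bool) : finPre (boolPair u (boolPair r y)) = boolPair u y := by
  simp [finPre]

/-- `finPre ∈ FP`. [folklore] -/
theorem finPre_mem_FP : finPre ∈ FP :=
  fanoutFn_mem_FP fstF_mem_FP (comp_mem_FP sndF_mem_FP sndF_mem_FP)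

/-- Value of `finMap`. [folklore] -/
@[simp] theorem finMap_apply (v c qry : List Bool) :
    finMap (boolPair v (boolPair c qry)) = boolPair (fstF (sndF v)) qry := by
  simp [finMap]

/-- `finMap ∈ FP`. [folklore] -/
theorem finMap_mem_FP : finMap ∈ FP :=
  fanoutFn_mem_FP (comp_mem_FP fstF_mem_FP (comp_mem_FP sndF_mem_FP fstF_mem_FP))
    (comp_mem_FP sndF_mem_FP sndF_mem_FP)

/-- Value of the cap polynomial. [folklore] -/
@[simp] theorem capPoly_eval (k : ℕ) : (capPoly T).eval k = 2 * k + 2 + T.eval k := by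
  simp [capPoly]

/-- **The inner oracle algorithm is polynomial-time** when the verifier is.
[cite: AroraBarak2009, §3.4] -/
theorem isPolyTime_finAlg (hM : M.IsPolyTime encodingBoolBool) : (finAlg M q T).IsPolyTime encodingBoolBool :=
  isPolyTime_clockFst _ (isPolyTime_capQ _ (isPolyTime_mapQuery _ (isPolyTime_comap _ hM finPre_mem_FP)
    finMap_mem_FP) _ _) _ _

end Machine

/-! ### The languages -/

section Languages

variable (M : OracleAlg Bool) (q T : Polynomial ℕ)

/-- The language of the core machine with the `P`-oracle `SignRat` and budget `q(|u|)`: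
`{v | finCore accepts v within q(|first field of v|) rounds}`. [folklore] -/
def finMach : Language Bool :=
  {v | ((finCore M T).run (Oracle.ofLanguage SignRat) (q.eval (boolUnpair v).1.length) v).getD false = true}

/-- Re-association `⟨⟨u, r⟩, y⟩ ↦ ⟨u, ⟨r, y⟩⟩`. [folklore] -/
noncomputable def finRho : List Bool → List Bool :=
  fanoutFn (fstF ∘ fstF) (fanoutFn (sndF ∘ fstF) sndF)

/-- `⟨⟨u, r⟩, y⟩ ↦ ⟨u, y⟩` (for the witness-length test `|y| ≤ q(|u|)`). [folklore] -/
noncomputable def finLen : List Bool → List Bool :=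
  fanoutFn (fstF ∘ fstF) sndF

/-- The certificate language: `⟨⟨u, r⟩, y⟩` with `|y| ≤ q(|u|)` accepted by the core machine.
[cite: FournierKoiran2000, Thm 3 (p. 11: guess `z`, run `T` on `⟨q, z⟩`)] -/
def finCert : Language Bool :=
  (finRho ⁻¹' finMach M q T : Language Bool) ⊓ (finLen ⁻¹' LenLe q : Language Bool)

/-- **The final-check language** (of `polyExists` shape): `w = ⟨1ⁿ, r⟩` is a member iff some
witness `y` with `|y| ≤ q(|w|)` has `⟨w, y⟩ ∈ finCert`. [cite: FournierKoiran2000, Thm 3 (pp. 11–12)] -/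
def FinalCheck : Language Bool :=
  {w | ∃ y : List Bool, y.length ≤ q.eval w.length ∧ boolPair w y ∈ finCert M q T}

variable {M q T}

/-- Membership in the certificate language. [folklore] -/
theorem mem_finCert_iff (z : List Bool) : z ∈ finCert M q T ↔ finRho z ∈ finMach M q T ∧ finLen z ∈ LenLe q :=
  Iff.rfl

/-- Value of `finRho`. [folklore] -/
@[simp] theorem finRho_apply (u r y : List Bool) :
    finRho (boolPair (boolPair u r) y) = boolPair u (boolPair r y) := by
  simp [finRho]

/-- Value of `finLen`. [folklore] -/
@[simp] theorem finLen_apply (u r y : List Bool) : finLen (boolPair (boolPair u r) y) = boolPair u y := by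
  simp [finLen]

/-- `finRho ∈ FP`. [folklore] -/
theorem finRho_mem_FP : finRho ∈ FP :=
  fanoutFn_mem_FP (comp_mem_FP fstF_mem_FP fstF_mem_FP)
    (fanoutFn_mem_FP (comp_mem_FP sndF_mem_FP fstF_mem_FP) sndF_mem_FP)

/-- `finLen ∈ FP`. [folklore] -/
theorem finLen_mem_FP : finLen ∈ FP :=
  fanoutFn_mem_FP (comp_mem_FP fstF_mem_FP fstF_mem_FP) sndF_mem_FP

/-- **The core language is in `P^{SignRat}`**, decided by `finAlg M q T` with budget
`q + 1 + capPoly T`. [cite: AroraBarak2009, §3.4] -/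
theorem finMach_mem_PRel (hM : M.IsPolyTime encodingBoolBool) :
    finMach M q T ∈ PRel (Oracle.ofLanguage SignRat) := by
  refine ⟨finAlg M q T, isPolyTime_finAlg hM, q + 1 + capPoly T, fun v => ⟨?_, fun y hy => ?_⟩⟩
  · have hparts := length_boolUnpair_parts_le v
    have hfuel : q.eval (boolUnpair v).1.length < (q + 1 + capPoly T).eval v.length := by
      have h1 : q.eval (boolUnpair v).1.length ≤ q.eval v.length := TM2Iter.eval_mono q (by omega)
      simp only [eval_add, eval_one, capPoly_eval]
      omega
    rw [finAlg, clockFst, run_clockBy _ _ _ _ _ hfuel]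
    congr 1
    by_cases h : v ∈ finMach M q T
    · rw [(Set.mem_iff_boolIndicator _ _).1 h]; exact h
    · rw [(Set.notMem_iff_boolIndicator _ _).1 h]
      have h' : ¬ ((finCore M T).run (Oracle.ofLanguage SignRat) (q.eval (boolUnpair v).1.length) v).getD false = true := h
      simpa using h'
  · have h1 := queriesAux_clockBy_subset _ _ _ _ _ _ _ _ (show y ∈ (finAlg M q T).queriesAux _ v _ [] from hy)
    have h2 := length_le_of_mem_queriesAux_capQ _ _ _ _ _ _ _ _ h1
    simp only [eval_add, eval_one, capPoly_eval] at h2 ⊢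
    omega

/-- **The core language is in `P`** (`P^P = P`). [cite: FournierKoiran2000, Thm 3 (p. 12: "This … can be solved in polynomial time")] -/
theorem finMach_mem_P (hM : M.IsPolyTime encodingBoolBool) : finMach M q T ∈ Classes.P :=
  PRelClass_P_subset_P (mem_PRelClass_iff.2 ⟨SignRat, SignRat_mem_P, finMach_mem_PRel hM⟩)

/-- **The certificate language is in `P`.** [cite: FournierKoiran2000, Thm 3 (p. 12)] -/
theorem finCert_mem_P (hM : M.IsPolyTime encodingBoolBool) : finCert M q T ∈ Classes.P :=
  inter_mem_P (preimage_mem_P (finMach_mem_P hM) finRho_mem_FP) (preimage_mem_P (LenLe_mem_P q) finLen_mem_FP)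

/-- **The final check is in `NP`.** [cite: FournierKoiran2000, Thm 3 (p. 12: "a standard NP algorithm")] -/
theorem FinalCheck_mem_NP (hM : M.IsPolyTime encodingBoolBool) : FinalCheck M q T ∈ Nondeterministic.NP :=
  ⟨finCert M q T, finCert_mem_P hM, q, fun _ => Iff.rfl⟩

end Languages

/-! ### Semantics: the verifier run at the rational point -/

section Semantics

variable {M : OracleAlg Bool} {q T : Polynomial ℕ}

/-- Free-running transcripts of `M.comap pre` on `v` are those of `M` on `pre v`. [folklore] -/
theorem trans_comap (M : OracleAlg Bool) (pre : List Bool → List Bool) (O : Oracle) (v : List Bool) :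
    ∀ i, trans (M.comap pre) O v i = trans M O (pre v) i
  | 0 => rfl
  | i + 1 => by rw [trans_succ, trans_succ, trans_comap M pre O v i]; rfl

/-- Transcripts of a one-bit oracle consist of one-bit answers. [folklore] -/
theorem length_eq_one_of_mem_trans (M : OracleAlg Bool) {O : Oracle} (hO : ∀ w, (O w).length = 1)
    (x : List Bool) : ∀ i, ∀ a ∈ trans M O x i, a.length = 1
  | 0, a, ha => by simp at ha
  | i + 1, a, ha => by
    rw [trans_succ, List.mem_append, List.mem_singleton] at ha
    rcases ha with ha | rfl
    · exact length_eq_one_of_mem_trans M hO x i a ha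
    · exact hO _

/-- **The run of the core machine on a genuine input is the run of the verifier at the rational
point.** For `d > 0`, `|y| ≤ q(n)` and a query-length bound `T` of `M` (as produced by
`FKPointLocation.exists_query_length_bound`): with the oracle `SignRat`, budget `q(n)`,
`finCore M T` on `⟨1ⁿ, ⟨ratCode d N, y⟩⟩` runs as `M` with `signOracle (N/d)` on `⟨1ⁿ, y⟩`.
[cite: FournierKoiran2000, Thm 3 (p. 11: "running `T` on `⟨q, z⟩`")] -/
theorem finCore_run_eq
    (hT : ∀ (n : ℕ) (y : List Bool), y.length ≤ q.eval n →
      ∀ ans : List (List Bool), (∀ a ∈ ans, a.length = 1) → ans.length ≤ q.eval n →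
        ∀ qry, M.step (boolPair (unaryEncodeNat n) y) ans = Sum.inl qry → qry.length ≤ T.eval n)
    {d : ℕ} (hd : 0 < d) (N : List ℤ) (n : ℕ) {y : List Bool} (hy : y.length ≤ q.eval n) :
    (finCore M T).run (Oracle.ofLanguage SignRat) (q.eval n)
        (boolPair (unaryEncodeNat n) (boolPair (ratCode d N) y)) =
      M.run (signOracle (ratPoint d N)) (q.eval n) (boolPair (unaryEncodeNat n) y) := by
  -- the oracle seen by the verifier through the prefixed queries
  have hO₀eq : (fun qry => Oracle.ofLanguage SignRat (boolPair (ratCode d N) qry)) = signOracle (ratPoint d N) :=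
    funext fun qry => ofLanguage_SignRat_ratCode hd N qry
  have hone : ∀ w, ((fun qry => Oracle.ofLanguage SignRat (boolPair (ratCode d N) qry)) w).length = 1 :=
    fun w => by rw [hO₀eq]; rfl
  have hpre : finPre (boolPair (unaryEncodeNat n) (boolPair (ratCode d N) y)) = boolPair (unaryEncodeNat n) y :=
    finPre_apply _ _ _
  have hr : fstF (sndF (boolPair (unaryEncodeNat n) (boolPair (ratCode d N) y))) = ratCode d N := by simp
  have hagree : MapAgree (M.comap finPre) finMap (Oracle.ofLanguage SignRat)
      (fun qry => Oracle.ofLanguage SignRat (boolPair (ratCode d N) qry))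
      (boolPair (unaryEncodeNat n) (boolPair (ratCode d N) y)) := by
    intro i qry _ _
    rw [finMap_apply, hr]
  have hlen : (boolPair (unaryEncodeNat n) (boolPair (ratCode d N) y)).length =
      2 * n + 2 + (2 * (ratCode d N).length + 2 + y.length) := by
    rw [length_boolPair, length_boolPair, length_unaryEncodeNat]
  -- the cap never acts on the genuine run
  have hcap : ∀ z ∈ ((M.comap finPre).mapQuery finMap).queries (Oracle.ofLanguage SignRat) (q.eval n)
      (boolPair (unaryEncodeNat n) (boolPair (ratCode d N) y)),
      z.length ≤ (capPoly T).eval (boolPair (unaryEncodeNat n) (boolPair (ratCode d N) y)).length := by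
    intro z hz
    obtain ⟨i, qry, -, -, hq, hz'⟩ := queries_mapQuery _ _ _ _ _ hagree _ hz
    rw [hz', finMap_apply, hr, length_boolPair, capPoly_eval]
    obtain ⟨j, hj, hallj, hqry⟩ := OracleCompose.exists_of_mem_queries _ _ (q.eval n) _ qry hq
    obtain ⟨y', hy'⟩ := hallj j le_rfl
    have hqq : qry = y' := by rw [hqry, qryOf_eq_of_step_eq hy']
    rw [OracleAlg.comap_step, trans_comap, hpre] at hy'
    rw [hqq] at hqry ⊢
    have hb := hT n y hy _ (length_eq_one_of_mem_trans M hone _ j)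
      (by rw [OracleCompose.length_trans]; omega) y' hy'
    have hT' : T.eval n ≤ T.eval (boolPair (unaryEncodeNat n) (boolPair (ratCode d N) y)).length :=
      TM2Iter.eval_mono T (by rw [hlen]; omega)
    rw [hlen] at hT' ⊢
    omega
  rw [finCore, (run_capQ _ _ _ _ _ _ hcap).1, run_mapQuery _ _ _ _ _ hagree, OracleAlg.run, runAux_comap,
    hpre, hO₀eq]
  rfl

/-- **Membership of a genuine input in the core language** is acceptance of the verifier at the
rational point within `q(n)` rounds. [cite: FournierKoiran2000, Thm 3 (p. 11)] -/
theorem mem_finMach_iff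
    (hT : ∀ (n : ℕ) (y : List Bool), y.length ≤ q.eval n →
      ∀ ans : List (List Bool), (∀ a ∈ ans, a.length = 1) → ans.length ≤ q.eval n →
        ∀ qry, M.step (boolPair (unaryEncodeNat n) y) ans = Sum.inl qry → qry.length ≤ T.eval n)
    {d : ℕ} (hd : 0 < d) (N : List ℤ) (n : ℕ) {y : List Bool} (hy : y.length ≤ q.eval n) :
    boolPair (unaryEncodeNat n) (boolPair (ratCode d N) y) ∈ finMach M q T ↔
      M.run (signOracle (ratPoint d N)) (q.eval n) (boolPair (unaryEncodeNat n) y) = some true := by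
  change ((finCore M T).run (Oracle.ofLanguage SignRat)
    (q.eval (boolUnpair (boolPair (unaryEncodeNat n) (boolPair (ratCode d N) y))).1.length) _).getD false = true ↔ _
  rw [boolUnpair_boolPair, length_unaryEncodeNat, finCore_run_eq hT hd N n hy]
  cases M.run (signOracle (ratPoint d N)) (q.eval n) (boolPair (unaryEncodeNat n) y) with
  | none => simp
  | some b => cases b <;> simp

/-- **The final check at a rational point**: `⟨1ⁿ, ratCode d N⟩ ∈ FinalCheck M q T` iff some
witness `y`, `|y| ≤ q(n)`, is accepted by the verifier at `N/d` within `q(n)` rounds — the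
`NDPAdd` acceptance condition with `signOracle (N/d)`. [cite: FournierKoiran2000, Thm 3 (pp. 11–12)] -/
theorem mem_FinalCheck_iff
    (hT : ∀ (n : ℕ) (y : List Bool), y.length ≤ q.eval n →
      ∀ ans : List (List Bool), (∀ a ∈ ans, a.length = 1) → ans.length ≤ q.eval n →
        ∀ qry, M.step (boolPair (unaryEncodeNat n) y) ans = Sum.inl qry → qry.length ≤ T.eval n)
    {d : ℕ} (hd : 0 < d) (N : List ℤ) (n : ℕ) :
    boolPair (unaryEncodeNat n) (ratCode d N) ∈ FinalCheck M q T ↔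
      ∃ y : List Bool, y.length ≤ q.eval n ∧
        M.run (signOracle (ratPoint d N)) (q.eval n) (boolPair (unaryEncodeNat n) y) = some true := by
  constructor
  · rintro ⟨y, -, hcert⟩
    obtain ⟨hm, hl⟩ := (mem_finCert_iff _).1 hcert
    rw [finLen_apply, boolPair_mem_LenLe, length_unaryEncodeNat] at hl
    rw [finRho_apply, mem_finMach_iff hT hd N n hl] at hm
    exact ⟨y, hl, hm⟩
  · rintro ⟨y, hy, hrun⟩
    refine ⟨y, hy.trans (TM2Iter.eval_mono q ?_), (mem_finCert_iff _).2 ⟨?_, ?_⟩⟩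
    · rw [length_boolPair, length_unaryEncodeNat]; omega
    · rw [finRho_apply]
      exact (mem_finMach_iff hT hd N n hy).2 hrun
    · rw [finLen_apply, boolPair_mem_LenLe, length_unaryEncodeNat]
      exact hy

/-- **The final check at a point of the face of `x`.** If the sign oracles of `x ∈ ℝᵏ` and of the
rational point `N/d` give the same answer to every query the verifier can ask on the inputs
`⟨1ⁿ, y⟩`, `|y| ≤ q(n)`, after one-bit transcripts of length `< q(n)` (this is what locating `x`
in the arrangement of all test hyperplanes provides, report p. 11), then
`⟨1ⁿ, ratCode d N⟩ ∈ FinalCheck M q T` iff some `y`, `|y| ≤ q(n)`, is accepted AT `x` within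
`q(n)` rounds. [cite: FournierKoiran2000, Thm 3 (p. 11: "`P_S` is included in a face of `𝒜(ℋₙ)`")] -/
theorem mem_FinalCheck_iff_of_agree
    (hT : ∀ (n : ℕ) (y : List Bool), y.length ≤ q.eval n →
      ∀ ans : List (List Bool), (∀ a ∈ ans, a.length = 1) → ans.length ≤ q.eval n →
        ∀ qry, M.step (boolPair (unaryEncodeNat n) y) ans = Sum.inl qry → qry.length ≤ T.eval n)
    {d : ℕ} (hd : 0 < d) (N : List ℤ) (n : ℕ) {k : ℕ} (x : Fin k → ℝ)
    (hagree : ∀ y : List Bool, y.length ≤ q.eval n →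
      ∀ ans : List (List Bool), (∀ a ∈ ans, a.length = 1) → ans.length < q.eval n →
        ∀ qry, M.step (boolPair (unaryEncodeNat n) y) ans = Sum.inl qry →
          signOracle x qry = signOracle (ratPoint d N) qry) :
    boolPair (unaryEncodeNat n) (ratCode d N) ∈ FinalCheck M q T ↔
      ∃ y : List Bool, y.length ≤ q.eval n ∧
        M.run (signOracle x) (q.eval n) (boolPair (unaryEncodeNat n) y) = some true := by
  rw [mem_FinalCheck_iff hT hd N n]
  have key : ∀ y : List Bool, y.length ≤ q.eval n →
      M.run (signOracle x) (q.eval n) (boolPair (unaryEncodeNat n) y) =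
        M.run (signOracle (ratPoint d N)) (q.eval n) (boolPair (unaryEncodeNat n) y) := fun y hy =>
    FKPointLocation.runAux_eq_of_agree_oneBit M (fun w => length_signOracle x w) _ (q.eval n)
      (hagree y hy) (q.eval n) [] (fun a ha => by simp at ha) (by simp)
  constructor
  · rintro ⟨y, hy, h⟩; exact ⟨y, hy, by rw [key y hy]; exact h⟩
  · rintro ⟨y, hy, h⟩; exact ⟨y, hy, by rw [← key y hy]; exact h⟩

end Semantics

end FKTransfer

end Literature.Computability.Complexity
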